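import Summits.ABC.ABC.Theses.IsogenyGlueCongruence
import Literature.NumberTheory.EllipticCurves.PastenCongruenceModulusProofs
import Literature.NumberTheory.EllipticCurves.NewformsLevelRaising
import Literature.NumberTheory.EllipticCurves.NewformsStrongMultiplicityOne
import Literature.NumberTheory.EllipticCurves.NewformsMultiplicityOneProofs
import Literature.NumberTheory.EllipticCurves.NewformsHeckeStableProofs
import Literature.NumberTheory.EllipticCurves.NewformsFiniteProofs
import HarnessLib

/-!
# Crux A `DegreePrimesPolyBounded` (stmt-ABC-2045), line `Sketch` — stub `stub_minimalPrimes`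

The stub `stub_minimalPrimes` of the line `Sketch` for the crux
`Summit.ABC.ABC.Theses.IsogenyGlueCongruence.DegreePrimesPolyBounded`: **every minimal prime of the
anemic Hecke ring `𝕋 = ℤ[T_p : p ∤ N] ⊆ End_ℂ S₂(Γ₀(N))` is the eigen-ideal of a newform of level
`N`, or of the level-`N` inclusion of a newform of a proper divisor level `M ∣ N`** (Pasten 2024,
§4.9–4.11: "the minimal primes of `𝕋` are exactly the kernels `𝕀_[χ]` of the classes of systems of
Hecke eigenvalues"; Atkin–Lehner 1970, Thm. 5).

Everything needed is already proved in the tree, and this file assembles it (all weights `k`):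

* `S_k(Γ₀(N)) = ∑_{M d ∣ N} [α_d]_k S_k(Γ₀(M))^{new}` (`iSup_atkinLehnerComponent_eq_top`,
  `NewformsStrongMultiplicityOne`) and `S_k(Γ₀(M))^{new} = span (newforms)` (`span_newforms0_holds`,
  `NewformsHeckeStableProofs`), so `S_k(Γ₀(N))` is spanned by the forms `[α_d]_k g`, `g` a newform of
  level `M ∣ N`;
* `T_p [α_d]_k = [α_d]_k T_p` for `p ∤ N` (`heckeT_degeneracyMap0`, `NewformsMultiplicityOneProofs`),
  so `[α_d]_k g` and the inclusion `toLevel0 g = [α_1]_k g` are simultaneous `T_p`-eigenvectors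
  (`p ∤ N`) with the same eigenvalues `a_p(g)`; hence every `t ∈ 𝕋` acts on both by the same scalar
  (induction over `𝕋 = ℤ[T_p]`) and `eigenIdeal (toLevel0 g) ≤ eigenIdeal ([α_d]_k g)`;
* `𝕋 ⊆ End S_k(Γ₀(N))` acts faithfully, so the (finite, `finite_newforms0_holds`) intersection of the
  prime ideals `eigenIdeal (toLevel0 g)` is `0`; a prime containing a finite intersection of ideals
  contains one of them (`Ideal.IsPrime.inf_le'`), and a minimal prime equals it.

No new definition, no named fact; nothing of the tree is restated.
-/

-- `Summit.ABC.ABC` is the mandated summit-side namespace (CONVENTIONS §2); the duplicate is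
-- deliberate.
set_option linter.dupNamespace false

noncomputable section

open scoped MatrixGroups ModularForm
open CongruenceSubgroup UpperHalfPlane
open Literature.NumberTheory.EllipticCurves.ModularForms

namespace Summit.ABC.ABC.Theorems.DegreePrimesPolyBounded

section General

variable {N : ℕ} [NeZero N] {k : ℤ}

/-- Two simultaneous eigenvectors `v, w` of the `T_p`, `p ∤ N`, with the same eigenvalues `a_p` are
acted on by every element of `𝕋 = ℤ[T_p : p ∤ N]` through the same scalar (induction over the
generators). [folklore] -/
theorem exists_apply_eq_smul_and_apply_eq_smul {v w : CuspForm (Gamma0 N) k} (a : ℕ → ℂ)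
    (hv : ∀ (p : ℕ) (hp : p.Prime), ¬p ∣ N →
      (haveI : NeZero p := ⟨hp.ne_zero⟩; heckeT (Gamma0 N) k p v) = a p • v)
    (hw : ∀ (p : ℕ) (hp : p.Prime), ¬p ∣ N →
      (haveI : NeZero p := ⟨hp.ne_zero⟩; heckeT (Gamma0 N) k p w) = a p • w)
    (t : anemicHeckeRing N k) :
    ∃ c : ℂ, (t : Module.End ℂ (CuspForm (Gamma0 N) k)) v = c • v ∧
      (t : Module.End ℂ (CuspForm (Gamma0 N) k)) w = c • w := by
  obtain ⟨t, ht⟩ := t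
  change ∃ c : ℂ, t v = c • v ∧ t w = c • w
  induction ht using Algebra.adjoin_induction with
  | mem x hx =>
    obtain ⟨p, hp, hpN, rfl⟩ := hx
    exact ⟨a p, hv p hp hpN, hw p hp hpN⟩
  | algebraMap r =>
    refine ⟨r, ?_, ?_⟩ <;>
      rw [Algebra.algebraMap_eq_smul_one, LinearMap.smul_apply, Module.End.one_apply,
        Int.cast_smul_eq_zsmul]
  | add x y _ _ hx hy =>
    obtain ⟨c, hc, hc'⟩ := hx
    obtain ⟨d, hd, hd'⟩ := hy
    exact ⟨c + d, by rw [LinearMap.add_apply, hc, hd, add_smul],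
      by rw [LinearMap.add_apply, hc', hd', add_smul]⟩
  | mul x y _ _ hx hy =>
    obtain ⟨c, hc, hc'⟩ := hx
    obtain ⟨d, hd, hd'⟩ := hy
    exact ⟨c * d, by rw [Module.End.mul_apply, hd, map_smul, hc, smul_smul, mul_comm],
      by rw [Module.End.mul_apply, hd', map_smul, hc', smul_smul, mul_comm]⟩

/-- If `v, w` are simultaneous eigenvectors of the `T_p`, `p ∤ N`, with the same eigenvalues and
`w ≠ 0`, then the eigen-ideal (annihilator in `𝕋`) of `w` is contained in that of `v`: an element of
`𝕋` acts on both by the same scalar. [folklore] -/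
theorem eigenIdeal_le_eigenIdeal_of_heckeT_eq_smul {v w : CuspForm (Gamma0 N) k} (a : ℕ → ℂ)
    (hv : ∀ (p : ℕ) (hp : p.Prime), ¬p ∣ N →
      (haveI : NeZero p := ⟨hp.ne_zero⟩; heckeT (Gamma0 N) k p v) = a p • v)
    (hw : ∀ (p : ℕ) (hp : p.Prime), ¬p ∣ N →
      (haveI : NeZero p := ⟨hp.ne_zero⟩; heckeT (Gamma0 N) k p w) = a p • w)
    (hw0 : w ≠ 0) : eigenIdeal w ≤ eigenIdeal v := by
  intro t ht
  obtain ⟨c, hc, hc'⟩ := exists_apply_eq_smul_and_apply_eq_smul a hv hw t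
  rw [mem_eigenIdeal] at ht ⊢
  rw [hc'] at ht
  have h0 : c = 0 := by
    rcases smul_eq_zero.mp ht with h | h
    · exact h
    · exact absurd h hw0
  rw [hc, h0, zero_smul]

/-- A newform is nonzero (`a₁ = 1`), in every weight. [folklore] -/
theorem ne_zero_of_isNewform0 {g : CuspForm (Gamma0 N) k} (hg : IsNewform0 g) : g ≠ 0 := by
  intro h
  have h1 : (qExpansion 1 ⇑g).coeff 1 = 1 := hg.2.2
  rw [h, CuspForm.coe_zero, UpperHalfPlane.qExpansion_zero, map_zero] at h1
  exact zero_ne_one h1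

/-- The inclusion `toLevel0 : S_k(Γ₀(M)) → S_k(Γ₀(N))`, `M ∣ N`, is the degeneracy map `[α_1]_k`
(both are the identity on functions). [folklore] -/
theorem toLevel0_eq_degeneracyMap0_one {M : ℕ} [NeZero M] (hM : M ∣ N) (g : CuspForm (Gamma0 M) k) :
    toLevel0 hM k g = degeneracyMap0 M N 1 k g :=
  DFunLike.coe_injective (by rw [coe_toLevel0, coe_degeneracyMap0_one M N k hM g])

/-- `T_p` commutes with the inclusion `S_k(Γ₀(M)) ⊆ S_k(Γ₀(N))` for `p ∤ N` prime
(`heckeT_degeneracyMap0` with `d = 1`; Diamond–Shurman Prop. 5.6.2). [folklore] -/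
theorem heckeT_toLevel0 {M : ℕ} [NeZero M] (hM : M ∣ N) {p : ℕ} [NeZero p] (hp : p.Prime)
    (hpN : ¬p ∣ N) (g : CuspForm (Gamma0 M) k) :
    heckeT (Gamma0 N) k p (toLevel0 hM k g) = toLevel0 hM k (heckeT (Gamma0 M) k p g) := by
  have h1 : M * 1 ∣ N := by rwa [mul_one]
  rw [toLevel0_eq_degeneracyMap0_one, toLevel0_eq_degeneracyMap0_one,
    heckeT_degeneracyMap0 h1 hp hpN]

omit [NeZero N] in
/-- The inclusion `toLevel0` of a nonzero form is nonzero (same function). [folklore] -/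
theorem toLevel0_ne_zero {M : ℕ} (hM : M ∣ N) {g : CuspForm (Gamma0 M) k} (hg : g ≠ 0) :
    toLevel0 hM k g ≠ 0 := fun h ↦
  hg (cuspFormOfLEₗ_injective (Gamma0GL_le_of_dvd hM) (h.trans (map_zero (toLevel0 hM k)).symm))

/-- The level-`N` inclusion of a newform `g` of level `M ∣ N` is a `T_p`-eigenvector with
eigenvalue `a_p(g)` for every prime `p ∤ N`. [folklore] -/
theorem heckeT_toLevel0_eq_coeff_smul {M : ℕ} [NeZero M] (hM : M ∣ N) {g : CuspForm (Gamma0 M) k}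
    (hg : IsNewform0 g) (p : ℕ) (hp : p.Prime) (hpN : ¬p ∣ N) :
    (haveI : NeZero p := ⟨hp.ne_zero⟩; heckeT (Gamma0 N) k p (toLevel0 hM k g)) =
      (qExpansion 1 ⇑g).coeff p • toLevel0 hM k g := by
  haveI : NeZero p := ⟨hp.ne_zero⟩
  rw [heckeT_toLevel0 hM hp hpN g, hg.heckeT_eq_coeff_smul hp, map_smul]

/-- The level-`N` inclusion of a newform of level `M ∣ N` is an anemic simultaneous eigenvector.
[folklore] -/
theorem isAnemicEigenvector_toLevel0 {M : ℕ} [NeZero M] (hM : M ∣ N) {g : CuspForm (Gamma0 M) k}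
    (hg : IsNewform0 g) : IsAnemicEigenvector (toLevel0 hM k g) :=
  fun p hp hpN ↦ ⟨_, heckeT_toLevel0_eq_coeff_smul hM hg p hp hpN⟩

variable (N k) in
/-- **`S_k(Γ₀(N))` is spanned by forms whose annihilator in `𝕋` contains the eigen-ideal of (the
level-`N` inclusion of) a newform of some level `M ∣ N`** — namely by the `[α_d]_k g`, `g` a newform
of level `M`, `M d ∣ N` (Atkin–Lehner decomposition, spanning half, `iSup_atkinLehnerComponent_eq_top`,
with `span_newforms0_holds`; and `T_p [α_d]_k = [α_d]_k T_p`, `heckeT_degeneracyMap0`).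
[cite: AtkinLehner1970, Thm. 5] -/
theorem span_setOf_eigenIdeal_toLevel0_le_eq_top :
    Submodule.span ℂ {v : CuspForm (Gamma0 N) k | ∃ (M : ℕ) (_ : NeZero M) (hM : M ∣ N)
      (g : CuspForm (Gamma0 M) k), IsNewform0 g ∧ eigenIdeal (toLevel0 hM k g) ≤ eigenIdeal v} =
      ⊤ := by
  rw [eq_top_iff, ← iSup_atkinLehnerComponent_eq_top k N]
  refine iSup_le fun x ↦ ?_
  have hspan : Submodule.span ℂ (newforms0 x.1.1 k) = newSubspace0 x.1.1 k :=
    span_newforms0_holds x.1.1 k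
  rw [atkinLehnerComponent, ← hspan, Submodule.map_span]
  refine Submodule.span_le.mpr ?_
  rintro _ ⟨g, hg, rfl⟩
  refine Submodule.subset_span ?_
  have hg' : IsNewform0 g := hg
  have hx : x.1.1 * x.1.2 ∣ N := x.2
  have hM : x.1.1 ∣ N := (dvd_mul_right _ _).trans hx
  refine ⟨x.1.1, inferInstance, hM, g, hg', ?_⟩
  refine eigenIdeal_le_eigenIdeal_of_heckeT_eq_smul (fun p ↦ (qExpansion 1 ⇑g).coeff p)
    (fun p hp hpN ↦ ?_) (heckeT_toLevel0_eq_coeff_smul hM hg')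
    (toLevel0_ne_zero hM (ne_zero_of_isNewform0 hg'))
  haveI : NeZero p := ⟨hp.ne_zero⟩
  rw [heckeT_degeneracyMap0 hx hp hpN, hg'.heckeT_eq_coeff_smul hp, map_smul]

/-- **`𝕋` acts faithfully**: an element of `𝕋 ⊆ End S_k(Γ₀(N))` lying in the eigen-ideal of the
level-`N` inclusion of every newform of every level `M ∣ N` is `0` (it kills a spanning set,
`span_setOf_eigenIdeal_toLevel0_le_eq_top`). [folklore] -/
theorem eq_zero_of_forall_mem_eigenIdeal_toLevel0 (t : anemicHeckeRing N k)
    (ht : ∀ (M : ℕ) (_ : NeZero M) (hM : M ∣ N) (g : CuspForm (Gamma0 M) k), IsNewform0 g →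
      t ∈ eigenIdeal (toLevel0 hM k g)) :
    t = 0 := by
  have h : (t : Module.End ℂ (CuspForm (Gamma0 N) k)) = 0 := by
    refine LinearMap.ext_on (span_setOf_eigenIdeal_toLevel0_le_eq_top N k) ?_
    rintro v ⟨M, hM0, hM, g, hg, hle⟩
    rw [LinearMap.zero_apply]
    exact mem_eigenIdeal.mp (hle (ht M hM0 hM g hg))
  exact Subtype.ext h

variable (N k) in
/-- The eigen-ideals of the level-`N` inclusions of the newforms of the levels `M ∣ N` form a
finite set of ideals of `𝕋` (finitely many newforms per level, `finite_newforms0_holds`). [folklore] -/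
theorem finite_setOf_eq_eigenIdeal_toLevel0 :
    {Q : Ideal (anemicHeckeRing N k) | ∃ (M : ℕ) (_ : NeZero M) (hM : M ∣ N)
      (g : CuspForm (Gamma0 M) k), IsNewform0 g ∧ Q = eigenIdeal (toLevel0 hM k g)}.Finite := by
  classical
  let F : ℕ → Set (Ideal (anemicHeckeRing N k)) := fun M ↦
    if h : M ≠ 0 ∧ M ∣ N then
      (haveI : NeZero M := ⟨h.1⟩;
        (fun g : CuspForm (Gamma0 M) k ↦ eigenIdeal (toLevel0 h.2 k g)) '' newforms0 M k)
    else ∅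
  have hF : ∀ M, (F M).Finite := by
    intro M
    simp only [F]
    split_ifs with h
    · haveI : NeZero M := ⟨h.1⟩
      exact (finite_newforms0_holds M k).image _
    · exact Set.finite_empty
  refine ((Finset.range (N + 1)).finite_toSet.biUnion fun M _ ↦ hF M).subset ?_
  rintro Q ⟨M, hM0, hM, g, hg, rfl⟩
  have hMle : M ∈ Finset.range (N + 1) :=
    Finset.mem_range.mpr (Nat.lt_succ_of_le (Nat.le_of_dvd (NeZero.pos N) hM))
  refine Set.mem_biUnion (Finset.mem_coe.mpr hMle) ?_
  have h : M ≠ 0 ∧ M ∣ N := ⟨NeZero.ne M, hM⟩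
  simp only [F, dif_pos h]
  exact ⟨g, hg, rfl⟩

/-- **The minimal primes of `𝕋` are eigen-ideals of (lifted) newforms** (Pasten 2024, §4.9–4.11;
Atkin–Lehner 1970, Thm. 5), in every weight: for a minimal prime `P` of
`𝕋 = anemicHeckeRing N k` there are `M ∣ N` and a newform `g ∈ S_k(Γ₀(M))` with
`P = eigenIdeal (toLevel0 g)`. Proof: the finite intersection of the primes `eigenIdeal (toLevel0 g)`
is `0` by faithfulness, so the prime `P` contains one of them, and equals it by minimality.
[cite: PastenShimura2024, §4.11 p. 16] -/
theorem exists_eq_eigenIdeal_toLevel0_of_mem_minimalPrimes {P : Ideal (anemicHeckeRing N k)}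
    (hP : P ∈ minimalPrimes (anemicHeckeRing N k)) :
    ∃ (M : ℕ) (_ : NeZero M) (hM : M ∣ N) (g : CuspForm (Gamma0 M) k),
      IsNewform0 g ∧ P = eigenIdeal (toLevel0 hM k g) := by
  classical
  rw [minimalPrimes_eq_minimals] at hP
  have hPprime : P.IsPrime := hP.1
  have hfin := finite_setOf_eq_eigenIdeal_toLevel0 N k
  have hinf : hfin.toFinset.inf id = ⊥ := by
    rw [eq_bot_iff]
    intro t ht
    rw [Submodule.mem_finsetInf] at ht
    rw [Ideal.mem_bot]
    refine eq_zero_of_forall_mem_eigenIdeal_toLevel0 t fun M hM0 hM g hg ↦ ?_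
    exact ht _ (hfin.mem_toFinset.mpr ⟨M, hM0, hM, g, hg, rfl⟩)
  have hle : hfin.toFinset.inf id ≤ P := by
    rw [hinf]
    exact bot_le
  obtain ⟨Q, hQ, hQP⟩ := (Ideal.IsPrime.inf_le' hPprime).mp hle
  obtain ⟨M, hM0, hM, g, hg, rfl⟩ := hfin.mem_toFinset.mp hQ
  refine ⟨M, hM0, hM, g, hg, le_antisymm (hP.2 ?_ hQP) hQP⟩
  exact isPrime_eigenIdeal (isAnemicEigenvector_toLevel0 hM hg)
    (toLevel0_ne_zero hM (ne_zero_of_isNewform0 hg))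

end General

/-- **Stub `stub_minimalPrimes`** (Atkin–Lehner 1970, Thm. 5 / Li 1975 with the faithful action
of `𝕋_N` on `S₂(Γ₀(N))`; Pasten 2024, §4.9–4.11): every minimal prime of the anemic Hecke ring
of level `N` is the eigen-ideal of a newform of level `N`, or of the level-`N` inclusion of a
newform of a proper divisor level (`exists_eq_eigenIdeal_toLevel0_of_mem_minimalPrimes`, split
according to `M = N`, where `toLevel0 (dvd_refl N) 2 g = g`). [cite: AtkinLehner1970, Thm. 5] -/
theorem stub_minimalPrimes :
    ∀ (N : ℕ) [NeZero N] (P : Ideal (anemicHeckeRing N 2)),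
      P ∈ minimalPrimes (anemicHeckeRing N 2) →
      (∃ g : CuspForm (Gamma0 N) 2, IsNewform0 g ∧ P = eigenIdeal g) ∨
      (∃ (M : ℕ) (_ : NeZero M) (hM : M ∣ N), M ≠ N ∧ ∃ g : CuspForm (Gamma0 M) 2,
        IsNewform0 g ∧ P = eigenIdeal (toLevel0 hM 2 g)) := by
  intro N _ P hP
  obtain ⟨M, hM0, hM, g, hg, hPeq⟩ := exists_eq_eigenIdeal_toLevel0_of_mem_minimalPrimes hP
  by_cases hMN : M = N
  · subst hMN
    left
    have hg' : toLevel0 hM 2 g = g := DFunLike.ext' rfl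
    refine ⟨g, hg, ?_⟩
    rw [hPeq, hg']
  · right
    exact ⟨M, hM0, hM, hMN, g, hg, hPeq⟩

end Summit.ABC.ABC.Theorems.DegreePrimesPolyBounded

end
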